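import Summits.QuantumFields.YangMills.Theorems.UnitScaleTiltProp7AvgSeqSpikeMass
import HarnessLib

/-!
# (q-gauge) «FR₂-lite» ROAD, BOOKKEEPING LETTER — **A SOURCED AVERAGING SEQUENCE KEEPS THE `ℓ¹`-CONTRACTION: `κ_{j+1} = Avg κ_j + S_j`, `κ₀ = 0` ⟹
# `Σ_y ‖κ_k y‖ ≤ Σ_{j<k} (L^{−d})^{k−1−j}·Σ_y ‖S_j y‖`, and with geometric sources `Σ‖S_j‖ ≤ (L^{−d})^{j+1}·m_j` ⟹ `Σ_y ‖κ_k y‖ ≤ (L^{−d})^k·Σ_{j<k} m_j`**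

Cell `ym3-torus` (HUMAN RULING D-0037, YM ladder rung R3 — SU(2) YM₃ on T³: NOT d = 4, NOT infinite volume, NOT a mass gap, NOT Clay).  Width seat `ym3-torus-px16` (gen 15);
THEOREMS ONLY (0 `def`, 0 `sorry`, default heartbeats); `--supports stmt-QuantumFields-19200 --as helper`; count-neutral; NO claim on crux ∕ stub ∕ registry.

WHY.  The (q-gauge) supplier's one open estimate «FR₂-lite» (the displayed `hFR2` of ✓`Prop7AvgHessGaugeHqGOfFR2.hqG_of_FR2_family`: the site mass of F4's chart×gauge mixed derivative
`κY` is `≤ C L·ℓ⁻²·s·‖A‖`) has, by the LOCATE memo of this seat (19200 evidence `LOCATE-FR2lite-blockcentre-px16g15.md`, kit j340935∕j340942), the structure of a SOURCED AVERAGING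
SEQUENCE: level by level `κ_{j+1}(y) = (Avg_{Ū₀ʲ} κ_j)(y) + S_j(y)`, `κ₀ = 0`, with `Avg` the SAME covariant block `Ad`-average that defines the averaging sequence `ns` of
✓`Prop7SymAvgTwSGaugeDir.QTwS_gaugeDir_of_avgSeq` ∕ ✓`Prop7AvgSeqSpikeMass`, and commutator sources `S_j` of mass `≤ 2σ_j·(L^{−d})^{j+1}·‖A‖` (`σ_j` a first-order linear-response sup
letter).  This file is the generic bookkeeping half: the `ℓ¹`-contraction of ✓`Prop7AvgSeqSpikeMass.sum_norm_avgStep_le` survives sources additively (§1), and geometric sources telescope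
to the top-level factor `(L^{−d})^k` EXACTLY (§2) — whence FR₂-lite's `ℓ⁻³·Σ_{j<k}σ_j ~ ℓ⁻²` once the recursion identity and the `σ_j` letter are supplied (NOT here).

WHAT IS PROVED (generic `P : Params`, normed ℂ-algebra `𝔸`; the holonomy norm letters `hV` displayed as in ✓`Prop7AvgSeqSpikeMass`).
* §1 ★★ `sum_norm_avgStepSourced_le` — ONE LEVEL: `κ′ = AvgStep κ + S` ⟹ `Σ_y ‖κ′ y‖ ≤ (L^d)⁻¹·Σ_x ‖κ x‖ + Σ_y ‖S y‖`.
* §2 ★★★ `sum_norm_avgSeqSourced_le_of_geom` — k LEVELS, geometric sources, `κ 0 = 0`: `Σ_y ‖κ k y‖ ≤ ((L^d)⁻¹)^k·Σ_{j<k} m j`;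
  ★★ `norm_avgSeqSourced_le_of_geom` — the pointwise edition `‖κ k y‖ ≤ ((L^d)⁻¹)^k·Σ_{j<k} m j`.
HONEST SCOPE.  Finite bookkeeping over a landed contraction lemma; the recursion identity for F4's `κY` and the `σ_j` letter are NOT here; nothing of «FR₂-lite», `hqG`, norm_H₁, norm_G, EX,
the crux or rung R3 is proved; the Yang–Mills mass gap is NOT proved.

References: T. Bałaban, CMP **98** (1985) 17–51 [Balaban1985Averaging] ((11) p.19, (97) p.32); CMP **99** (1985) 389–434 [Balaban1985BackgroundPropagators] ((3.19) p.393, (3.114)–(3.115)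
p.418); CMP **109** (1987) 249–301 [Balaban1987RG1] ((0.3)–(0.4) pp.252–253).
-/

set_option autoImplicit false

noncomputable section

open scoped BigOperators

namespace Summit.QuantumFields.YangMills.Theorems.Prop7AvgSeqSourcedMass

open Finset
open Literature.MathematicalPhysics.QuantumFieldTheory.Balaban1983to89
open T4Continuum BlockAveraging
open B10Eq27TorusAxialLog (holT transl)
open B7Prop1Explicit (disp)
open B7TransferAnalyticMean (meanCLM)
open Summit.QuantumFields.YangMills.Theorems.Prop7AvgSeqSpikeMass (sum_norm_avgStep_le)

variable {P : Params} {𝔸 : Type*} [NormedRing 𝔸] [NormedAlgebra ℂ 𝔸]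

/-! ## §1 One level with a source -/

/-- ★★ **ONE SOURCED AVERAGING LEVEL**: if `κ′ y = κ ŷ − mean_i(κ ŷ − P_i κ(x_i) P_i⁻¹) + S y` with norm-non-expanding stair holonomies `P_i = V(Γ_{y,i})` (standing range `j + 1 ≤ m + K`),
then `Σ_y ‖κ′ y‖ ≤ (L^d)⁻¹·Σ_x ‖κ x‖ + Σ_y ‖S y‖` — ✓`sum_norm_avgStep_le` applied to `κ′ − S`. [cite: Balaban1985Averaging, (97) p.32; Balaban1987RG1, (0.3)–(0.4) pp.252–253] -/
theorem sum_norm_avgStepSourced_le {j : ℕ} (hj : j + 1 ≤ P.m + P.K) (V : GaugeField P j 𝔸ˣ)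
    (hV : ∀ (y : Site P (j + 1)) (i : Idx P), ‖((holT V (emb y) (stairWord i.2.1 (off i.1)) : 𝔸ˣ) : 𝔸)‖ ≤ 1 ∧
      ‖(((holT V (emb y) (stairWord i.2.1 (off i.1)))⁻¹ : 𝔸ˣ) : 𝔸)‖ ≤ 1)
    (κ : Site P j → 𝔸) (κ' S : Site P (j + 1) → 𝔸)
    (hsucc : ∀ y : Site P (j + 1), κ' y = κ (emb y) - meanCLM (Idx P) 𝔸 (fun i : Idx P =>
        κ (emb y) - ((holT V (emb y) (stairWord i.2.1 (off i.1)) : 𝔸ˣ) : 𝔸) * κ (transl (emb y) (disp (stairWord i.2.1 (off i.1))))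
          * (((holT V (emb y) (stairWord i.2.1 (off i.1)))⁻¹ : 𝔸ˣ) : 𝔸)) + S y) :
    ∑ y : Site P (j + 1), ‖κ' y‖ ≤ ((P.L : ℝ) ^ P.d)⁻¹ * ∑ x : Site P j, ‖κ x‖ + ∑ y : Site P (j + 1), ‖S y‖ := by
  -- the unsourced part `κ′ − S` is an averaging step
  have hstep := sum_norm_avgStep_le hj V hV κ (fun y => κ' y - S y) (fun y => by rw [hsucc y, add_sub_cancel_right])
  calc ∑ y : Site P (j + 1), ‖κ' y‖ = ∑ y : Site P (j + 1), ‖(κ' y - S y) + S y‖ := by simp only [sub_add_cancel]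
    _ ≤ ∑ y : Site P (j + 1), (‖κ' y - S y‖ + ‖S y‖) := sum_le_sum fun y _ => norm_add_le _ _
    _ = ∑ y : Site P (j + 1), ‖κ' y - S y‖ + ∑ y : Site P (j + 1), ‖S y‖ := sum_add_distrib
    _ ≤ ((P.L : ℝ) ^ P.d)⁻¹ * ∑ x : Site P j, ‖κ x‖ + ∑ y : Site P (j + 1), ‖S y‖ := by linarith [hstep]

/-! ## §2 k levels with geometric sources -/

/-- ★★★ **A SOURCED AVERAGING SEQUENCE WITH GEOMETRIC SOURCES**: `κ (j+1) = AvgStep_j (κ j) + S j` at every level `j` (norm-non-expanding holonomies of the level fields `V j`), `κ 0 = 0`,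
and `Σ_y ‖S j y‖ ≤ ((L^d)⁻¹)^(j+1)·m j` ⟹ `Σ_y ‖κ k y‖ ≤ ((L^d)⁻¹)^k·Σ_{j<k} m j` for every `k ≤ m + K`: the contraction of the later levels restores EXACTLY the top factor
`(L^d)^{−k}` on every source (FR₂-lite's `ℓ⁻³·Σσ_j`). [cite: Balaban1985Averaging, (11) p.19, (97) p.32; Balaban1985BackgroundPropagators, (3.19) p.393, (3.114)–(3.115) p.418] -/
theorem sum_norm_avgSeqSourced_le_of_geom (V : (j : ℕ) → GaugeField P j 𝔸ˣ)
    (hV : ∀ (j : ℕ) (y : Site P (j + 1)) (i : Idx P), ‖((holT (V j) (emb y) (stairWord i.2.1 (off i.1)) : 𝔸ˣ) : 𝔸)‖ ≤ 1 ∧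
      ‖(((holT (V j) (emb y) (stairWord i.2.1 (off i.1)))⁻¹ : 𝔸ˣ) : 𝔸)‖ ≤ 1)
    (κ : (j : ℕ) → Site P j → 𝔸) (S : (j : ℕ) → Site P (j + 1) → 𝔸) (m : ℕ → ℝ) (h0 : κ 0 = 0)
    (hsucc : ∀ (j : ℕ) (y : Site P (j + 1)), κ (j + 1) y = κ j (emb y) - meanCLM (Idx P) 𝔸 (fun i : Idx P =>
        κ j (emb y) - ((holT (V j) (emb y) (stairWord i.2.1 (off i.1)) : 𝔸ˣ) : 𝔸) * κ j (transl (emb y) (disp (stairWord i.2.1 (off i.1))))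
          * (((holT (V j) (emb y) (stairWord i.2.1 (off i.1)))⁻¹ : 𝔸ˣ) : 𝔸)) + S j y)
    (hS : ∀ j : ℕ, j + 1 ≤ P.m + P.K → ∑ y : Site P (j + 1), ‖S j y‖ ≤ (((P.L : ℝ) ^ P.d)⁻¹) ^ (j + 1) * m j) :
    ∀ k : ℕ, k ≤ P.m + P.K → ∑ y : Site P k, ‖κ k y‖ ≤ (((P.L : ℝ) ^ P.d)⁻¹) ^ k * ∑ j ∈ range k, m j
  | 0, _ => by simp [h0]
  | k + 1, hk => by
    have ih := sum_norm_avgSeqSourced_le_of_geom V hV κ S m h0 hsucc hS k (by omega)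
    have hstep := sum_norm_avgStepSourced_le hk (V k) (hV k) (κ k) (κ (k + 1)) (S k) (hsucc k)
    have hSk := hS k hk
    have hL : 0 ≤ ((P.L : ℝ) ^ P.d)⁻¹ := by positivity
    calc ∑ y : Site P (k + 1), ‖κ (k + 1) y‖ ≤ ((P.L : ℝ) ^ P.d)⁻¹ * ∑ x : Site P k, ‖κ k x‖ + ∑ y : Site P (k + 1), ‖S k y‖ := hstep
      _ ≤ ((P.L : ℝ) ^ P.d)⁻¹ * ((((P.L : ℝ) ^ P.d)⁻¹) ^ k * ∑ j ∈ range k, m j) + (((P.L : ℝ) ^ P.d)⁻¹) ^ (k + 1) * m k :=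
          add_le_add (mul_le_mul_of_nonneg_left ih hL) hSk
      _ = (((P.L : ℝ) ^ P.d)⁻¹) ^ (k + 1) * ∑ j ∈ range (k + 1), m j := by rw [sum_range_succ]; ring

/-- ★★ **POINTWISE EDITION**: under the same letters, `‖κ k y‖ ≤ ((L^d)⁻¹)^k·Σ_{j<k} m j` at every level-`k` site `y` — at the member's top level `k = K − n` (`d = 3`) this is
`ℓ⁻³·Σ_{j<k} m j`, FR₂-lite's shape once `m j ≲ σ_j‖A‖`, `σ_j ≲ Lʲ·s`. [cite: Balaban1985Averaging, (97) p.32; Balaban1985BackgroundPropagators, (3.114)–(3.115) p.418] -/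
theorem norm_avgSeqSourced_le_of_geom (V : (j : ℕ) → GaugeField P j 𝔸ˣ)
    (hV : ∀ (j : ℕ) (y : Site P (j + 1)) (i : Idx P), ‖((holT (V j) (emb y) (stairWord i.2.1 (off i.1)) : 𝔸ˣ) : 𝔸)‖ ≤ 1 ∧
      ‖(((holT (V j) (emb y) (stairWord i.2.1 (off i.1)))⁻¹ : 𝔸ˣ) : 𝔸)‖ ≤ 1)
    (κ : (j : ℕ) → Site P j → 𝔸) (S : (j : ℕ) → Site P (j + 1) → 𝔸) (m : ℕ → ℝ) (h0 : κ 0 = 0)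
    (hsucc : ∀ (j : ℕ) (y : Site P (j + 1)), κ (j + 1) y = κ j (emb y) - meanCLM (Idx P) 𝔸 (fun i : Idx P =>
        κ j (emb y) - ((holT (V j) (emb y) (stairWord i.2.1 (off i.1)) : 𝔸ˣ) : 𝔸) * κ j (transl (emb y) (disp (stairWord i.2.1 (off i.1))))
          * (((holT (V j) (emb y) (stairWord i.2.1 (off i.1)))⁻¹ : 𝔸ˣ) : 𝔸)) + S j y)
    (hS : ∀ j : ℕ, j + 1 ≤ P.m + P.K → ∑ y : Site P (j + 1), ‖S j y‖ ≤ (((P.L : ℝ) ^ P.d)⁻¹) ^ (j + 1) * m j)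
    {k : ℕ} (hk : k ≤ P.m + P.K) (y : Site P k) :
    ‖κ k y‖ ≤ (((P.L : ℝ) ^ P.d)⁻¹) ^ k * ∑ j ∈ range k, m j :=
  (single_le_sum (fun z _ => norm_nonneg (κ k z)) (mem_univ y)).trans (sum_norm_avgSeqSourced_le_of_geom V hV κ S m h0 hsucc hS k hk)

end Summit.QuantumFields.YangMills.Theorems.Prop7AvgSeqSourcedMass

end
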